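import Literature.AlgebraicGeometry.HodgeTheory.HomComplexSigma
import Literature.AlgebraicGeometry.Modules.ExtCohomologyComparison
import HarnessLib

/-!
# `I`-semiregularity of a strictly perfect complex in COHOMOLOGICAL form: `σ_q(x) = 0 ∈ H^{q+2}(X, Ω^q)` (`q ∈ I`) `⟹ x = 0`

PROMOTED LITERATURE COPY (librarian protocol (b); DEFREQ-CoherentISemiregular, cell pub-hsemireg) of §0 of the generic part of
`Summits/Ventures/HSemireg/PerfectComplexSigmaDoor.lean` (its §§1–4 — the venture's admissibility notion `sigmaAdmissible`, the door
`PerfectComplexSigmaTransfer` and its Weil-cell consumers — are venture hypotheses/consumers and are NOT copied); namespace now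
`Literature.AlgebraicGeometry.HodgeTheory.HomComplex`, declaration names kept.

For a scheme `X` over `Spec S`, a strictly perfect complex `K•` in the window `[a, b]` and a set `I` of form degrees, the complex-level
`I`-semiregularity `HomComplex.IsISemiregularC X K a b hK I` of `HomComplexSigma.lean` (joint injectivity of Buchweitz–Flenner's
`(σ_q)_{q ∈ I}`, [BF03, Def. 4.1 and §5], on `Ext²(K•, K•) = Hom_D(Q K•, (Q K•)⟦2⟧)`, `σ_q` valued in `Hom_D(Q 𝒪_X[0], (Q Ω^q[0])⟦q+2⟧)`) is
EQUIVALENT to the joint-kernel condition on the cohomology classes `sigmaCoh X K a b hK q x ∈ H^{q+2}(X, Ω^q_{X/S})`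
(`isISemiregularC_iff_coh`): both comparison maps — Mathlib's `Ext.homEquiv` and the tree's `extToCohomology`
(`Ext^i(𝒪_X, G) ≅ H^i(X, G)`, Hartshorne III Prop. 6.3 (c), PROVED in `Modules/ExtCohomologyComparison.lean` as `extToCohomology_bijective`) —
are additive bijections. This is the exact shape of the tree's module-level `IsISemiregular` (cohomology-valued `sigmaHigher`,
`SemiregularityHigherSigma.lean`), the form in which consumers (engines, the coherent rendering of BF03 Thm. 5.1 in
`SemiregularVariationalHodgeISemiregularCoherent.lean`) read «`σ_I` injective». Everything is PROVED; no definition, no named fact.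

## References
* [BuchweitzFlenner2003] R.-O. Buchweitz, H. Flenner, Compositio Math. 137 (2003), Def. 4.1 (arXiv p. 20 L47–57) and §5
  («`ℰ_0` is called `I`-semiregular if the part `σ_I` of the semiregularity map is injective», arXiv p. 25 L52–62).
* [Hartshorne1977] R. Hartshorne, *Algebraic Geometry*, III Prop. 6.3 (c) (`Ext^i(𝒪_X, 𝒢) ≅ H^i(X, 𝒢)`).
-/

noncomputable section

open CategoryTheory CategoryTheory.Limits AlgebraicGeometry

namespace Literature.AlgebraicGeometry.HodgeTheory

open Literature.AlgebraicGeometry.Modules Literature.AlgebraicGeometry.Motives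

namespace HomComplex

section Coh

universe w₁ u₁

variable {S : Type u₁} [CommRing S] (X : Over (Spec (CommRingCat.of S))) [HasDerivedCategory.{w₁} X.left.Modules]
  (K : CochainComplex X.left.Modules ℤ) (a b : ℤ) [K.IsStrictlyGE a] [K.IsStrictlyLE b]
  (hK : ∀ p, IsFiniteLocallyFree (K.X p))

/-- `σ_q(x) = 0` in `Hom_D(Q 𝒪_X[0], (Q Ω^q[0])⟦q+2⟧)` forces the class `σ_q(x) = 0` in `H^{q+2}(X, Ω^q)` (both comparison maps
`Ext.homEquiv.symm` and `extToCohomology` are additive). [cite: BuchweitzFlenner2003, Def. 4.1] -/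
theorem sigmaCoh_eq_zero_of_sigmaC_eq_zero (q : ℕ) (x : ShiftedHom (DerivedCategory.Q.obj K) (DerivedCategory.Q.obj K) (2 : ℤ))
    (h : sigmaC X K a b hK q x = 0) : sigmaCoh X K a b hK q x = 0 := by
  have h' : sigmaExt X K a b hK q x = 0 := by
    change Abelian.Ext.homAddEquiv.symm (sigmaC X K a b hK q x) = 0
    rw [h]
    exact map_zero Abelian.Ext.homAddEquiv.symm
  change Literature.AlgebraicGeometry.HodgeTheory.extToCohomology (hodgeSheaf X q) (q + 2) (sigmaExt X K a b hK q x) = 0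
  rw [h', map_zero]

/-- **The cohomological joint-kernel condition implies `I`-semiregularity**: if `σ_q(x) = 0 ∈ H^{q+2}(X, Ω^q)` for all `q ∈ I`
forces `x = 0`, then `(σ_q)_{q ∈ I}` is jointly injective on `Ext²(K•, K•)` (this direction uses only additivity of the comparison
maps). [cite: BuchweitzFlenner2003, §5 (I-semiregular)] -/
theorem IsISemiregularC.of_coh (I : Set ℕ)
    (h : ∀ x : ShiftedHom (DerivedCategory.Q.obj K) (DerivedCategory.Q.obj K) (2 : ℤ),
      (∀ q ∈ I, sigmaCoh X K a b hK q x = 0) → x = 0) :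
    IsISemiregularC X K a b hK I :=
  (isISemiregularC_iff_ker X K a b hK I).2 fun x hx => h x fun q hq => sigmaCoh_eq_zero_of_sigmaC_eq_zero X K a b hK q x (hx q hq)

/-- `σ_q(x) = 0` in `H^{q+2}(X, Ω^q)` forces `σ_q(x) = 0` in `Hom_D`: both comparison maps are injective — `Ext.homEquiv` is a
bijection (Mathlib) and `Ext^i_{𝒪_X}(𝒪_X, G) → H^i(X, G)` is bijective (the tree's `extToCohomology_bijective`, Hartshorne
III.6.3 (c)). [cite: Hartshorne1977, III Prop. 6.3 (c)] -/
theorem sigmaC_eq_zero_of_sigmaCoh_eq_zero (q : ℕ) (x : ShiftedHom (DerivedCategory.Q.obj K) (DerivedCategory.Q.obj K) (2 : ℤ))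
    (h : sigmaCoh X K a b hK q x = 0) : sigmaC X K a b hK q x = 0 := by
  have h1 : sigmaExt X K a b hK q x = 0 :=
    (Literature.AlgebraicGeometry.Modules.extToCohomology_bijective (hodgeSheaf X q) (q + 2)).1
      (h.trans (map_zero _).symm)
  have h2 : Abelian.Ext.homAddEquiv.symm (sigmaC X K a b hK q x) =
      Abelian.Ext.homAddEquiv.symm (0 : ShiftedHom (DerivedCategory.Q.obj ((HomologicalComplex.single X.left.Modules
        (ComplexShape.up ℤ) 0).obj (unitModule X.left))) (DerivedCategory.Q.obj ((HomologicalComplex.single X.left.Modules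
        (ComplexShape.up ℤ) 0).obj (hodgeSheaf X q))) ((q + 2 : ℕ) : ℤ)) :=
    h1.trans (map_zero Abelian.Ext.homAddEquiv.symm).symm
  exact Abelian.Ext.homAddEquiv.symm.injective h2

/-- **`I`-semiregularity of a strictly perfect complex, COHOMOLOGICAL form**: `(σ_q)_{q ∈ I}` is jointly injective on `Ext²(K•, K•)`
iff `σ_q(x) = 0 ∈ H^{q+2}(X, Ω^q)` for all `q ∈ I` forces `x = 0` — the exact shape of the tree's module-level `IsISemiregular`
(cohomology-valued `sigmaHigher`), so the two notions can be compared term by term once `σ_q^C(E₀[0]) = σ_q(E₀)` (the column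
anchor, seat gs-g4) is in the tree. [cite: BuchweitzFlenner2003, §5 (I-semiregular)] [cite: Hartshorne1977, III Prop. 6.3 (c)] -/
theorem isISemiregularC_iff_coh (I : Set ℕ) :
    IsISemiregularC X K a b hK I ↔
      ∀ x : ShiftedHom (DerivedCategory.Q.obj K) (DerivedCategory.Q.obj K) (2 : ℤ),
        (∀ q ∈ I, sigmaCoh X K a b hK q x = 0) → x = 0 :=
  ⟨fun h x hx => (isISemiregularC_iff_ker X K a b hK I).1 h x fun q hq =>
      sigmaC_eq_zero_of_sigmaCoh_eq_zero X K a b hK q x (hx q hq),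
    IsISemiregularC.of_coh X K a b hK I⟩

end Coh

end HomComplex

end Literature.AlgebraicGeometry.HodgeTheory

end
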